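import Mathlib
import Literature.Topology.FourManifolds.TwoHandleTubeDeformationFour
import Literature.Topology.FourManifolds.LefschetzHandlebody
import Literature.AlgebraicTopology.SingularHomology.ExcisionMayerVietorisProofs
import Summits.SmoothPoincare4.SmoothPoincare4.Theorems.ConvexBisectionAcyclicBisectionExistsMultiAttachmentHomologyLoops
import Summits.SmoothPoincare4.SmoothPoincare4.Theorems.ConvexBisectionAcyclicBisectionExistsMultiAttachmentH1Model
import Summits.SmoothPoincare4.SmoothPoincare4.Theorems.ConvexBisectionAcyclicBisectionExistsMultiAttachmentH1Cores
import Summits.SmoothPoincare4.SmoothPoincare4.Theorems.ConvexBisectionAcyclicBisectionExistsMultiAttachmentHkCover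
import Summits.SmoothPoincare4.SmoothPoincare4.Theorems.ConvexBisectionAcyclicBisectionExistsMultiAttachmentH1
import HarnessLib

/-!
# `Hₖ`, `k ≥ 2`, of a Kosinski multi-attachment of 4-dimensional 2-handles with independent
# attaching classes: `Hₖ(X; R) ≅ Hₖ(V; R)`; acyclicity when the classes are a basis of `H₁(V; R)`
(helper for stub `stub_isLefschetzHandlebody_homology` = NF5
`Literature.Topology.FourManifolds.LefschetzBase.isLefschetzHandlebody_homology`, line
`modp-braid-orbits` r9, crux `ConvexBisection.AcyclicBisectionExists`, item stmt-SmoothPoincare4-10508;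
wave 3 / W3-2: assembly of E2 and the topological content of clause 3 of NF5)

* §1 the punctured tube `T ∖ S` of a 4-dimensional 2-handle is a homology circle:
  `Hₖ(T ∖ S; R) = 0` for `k ≥ 2` (it retracts onto the parallel circle `K_{1/2} ≅ 𝕊¹`,
  `TwoHandleTubeDeformationFour.lean`; `Hₖ(𝕊¹) = 0`, Hatcher Cor. 2.14);
* §2 degrees `≥ 3` of a cover by acyclic pieces with edges acyclic above degree `1`
  (`isIso_map_add_three_cover`, no hypothesis on the edge classes);
* §3 **E2 (`IsMultiAttachment.nonempty_iso_of_linearIndependent`)**: for `X = V ∪ H² ∪ ⋯ ∪ H²` (`HandleAttachingMap.IsMultiAttachment h IP X`) whose attaching classes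
  `h(loopPath (h i).attachingCircle) ∈ H₁(V; R)` are linearly independent,
  `Hₖ₊₂(X; R) ≅ Hₖ₊₂(V; R)` (Gompf–Stipsicz 1999, §4.4: the Mayer–Vietoris step over Kosinski's
  cover, `…MultiAttachmentHkCover.lean`, with the edge `H₁(T ∖ S) = R → H₁(A)` injective by
  independence), and **`IsMultiAttachment.nonempty_iso_add_three`**: `Hₖ₊₃(X; R) ≅ Hₖ₊₃(V; R)`
  unconditionally;
* §4 **acyclicity (`IsMultiAttachment.isZero_of_span_eq_top`)**: if moreover the attaching
  classes span `H₁(V; R)` and `Hₖ(V; R) = 0` for `k ≥ 2`, then `Hₖ(X; R) = 0` for all `k ≥ 1`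
  (with E1, `…MultiAttachmentH1.lean`), and the registered sub-goal stub `stub_multiAttachment_Hk`
  (E2); clause 3 of NF5 follows over `ℤ` and Betti numbers in `…MultiAttachmentAcyclic.lean`.

Everything is proved; no named facts, no `sorry` (one private definition, the circle map).
References: R. E. Gompf, A. I. Stipsicz, *4-Manifolds and Kirby Calculus* (1999), §4.4, §8.2
[GompfStipsicz1999]; A. Hatcher,
*Algebraic Topology* (2002), §2.2, Cor. 2.14 [HatcherAT2002]; A. A. Kosinski, *Differential
Manifolds* (1993), VI §6 [Kosinski1993]; A. Kas, Pacific J. Math. 89 (1980) [Kas1980].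
-/

noncomputable section

-- the prescribed namespace `Summit.<P>.<Sub>.…` duplicates `SmoothPoincare4` (P = Sub)
set_option linter.dupNamespace false

open scoped Manifold ContDiff Topology
open Set Function Metric CategoryTheory CategoryTheory.Limits
open Literature.AlgebraicTopology.SingularHomology Literature.AlgebraicTopology.Homotopy
open Literature.Topology.FourManifolds Literature.Topology.FourManifolds.LefschetzBase
open Literature.Topology.FourManifolds.HandleShrink

namespace Summit.SmoothPoincare4.SmoothPoincare4.Theorems.AcyclicBisectionExists.ModpBraidOrbits

variable (R : Type) [CommRing R]

/-! ## §1 The punctured tube is a homology circle -/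

/-- The point `(θ/2, 0)` of the parallel circle `K_{1/2} ⊆ T`. [cite: Kosinski1993, VI §6] -/
private def circPt (θ : sphere (0 : EuclideanSpace ℝ (Fin 2)) 1) : ↥(handleTube 3 2) :=
  ⟨⟨(2⁻¹ : ℝ) • corePt θ, by
      rw [mem_closedBall_zero_iff, norm_smul, norm_corePt, mul_one]; norm_num⟩, by
    rw [mem_handleTube]
    show lamSq 2 ((2⁻¹ : ℝ) • corePt θ) ≠ 0
    rw [lamSq_smul, lamSq_corePt]; norm_num⟩

/-- The parallel circle `K_{1/2}` is the (homeomorphic) image of `𝕊¹` under `circPt`. [folklore] -/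
private theorem range_circPt : range circPt =
    {y : ↥(handleTube 3 2) | lamSq 2 y.1.1 = (2⁻¹ : ℝ) ^ 2 ∧ muSq 2 y.1.1 = 0} := by
  ext y
  constructor
  · rintro ⟨θ, rfl⟩
    refine ⟨?_, ?_⟩
    · show lamSq 2 ((2⁻¹ : ℝ) • corePt θ) = _
      rw [lamSq_smul, lamSq_corePt, mul_one]
    · show muSq 2 ((2⁻¹ : ℝ) • corePt θ) = 0
      rw [← blockScale_self_eq_smul, muSq_blockScale, muSq_corePt, mul_zero]
  · rintro ⟨hl, hm⟩
    set u : EuclideanSpace ℝ (Fin 4) := y.1.1 with hu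
    have h2 : u 2 = 0 := apply_eq_zero_of_muSq_eq_zero hm (i := 2) (by norm_num)
    have h3 : u 3 = 0 := apply_eq_zero_of_muSq_eq_zero hm (i := 3) (by norm_num)
    rw [lamSq_two_fin_four] at hl
    let v : EuclideanSpace ℝ (Fin 2) := WithLp.toLp 2 ![u 0 / 2⁻¹, u 1 / 2⁻¹]
    have hv : ‖v‖ = 1 := by
      have : ‖v‖ ^ 2 = 1 := by
        rw [EuclideanSpace.norm_sq_eq, Fin.sum_univ_two, Real.norm_eq_abs, Real.norm_eq_abs,
          sq_abs, sq_abs]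
        simp only [v]
        rw [Matrix.cons_val_zero, Matrix.cons_val_one, Matrix.cons_val_zero, div_pow, div_pow,
          ← add_div, hl, div_self (by norm_num)]
      nlinarith [norm_nonneg v]
    refine ⟨⟨v, mem_sphere_zero_iff_norm.2 hv⟩, ?_⟩
    apply Subtype.ext; apply Subtype.ext
    show (2⁻¹ : ℝ) • corePt _ = u
    ext i
    fin_cases i
    · show 2⁻¹ * (u 0 / 2⁻¹) = u 0
      field_simp
    · show 2⁻¹ * (u 1 / 2⁻¹) = u 1
      field_simp
    · show 2⁻¹ * 0 = u 2
      rw [h2, mul_zero]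
    · show 2⁻¹ * 0 = u 3
      rw [h3, mul_zero]

/-- **`Hₖ₊₂` of the parallel circle `K_{1/2} ≅ 𝕊¹` vanishes.** [cite: HatcherAT2002, Cor. 2.14] -/
theorem isZero_singularHomology_parallelCircle (k : ℕ) : IsZero (singularHomology R R
    ↥{y : ↥(handleTube 3 2) | lamSq 2 y.1.1 = (2⁻¹ : ℝ) ^ 2 ∧ muSq 2 y.1.1 = 0} (k + 2)) := by
  have hc0 : Continuous fun θ : sphere (0 : EuclideanSpace ℝ (Fin 2)) 1 => (2⁻¹ : ℝ) • corePt θ :=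
    continuous_corePt.const_smul (2⁻¹ : ℝ)
  have hc : Continuous circPt := (hc0.subtype_mk _).subtype_mk _
  have hinj : Function.Injective circPt := fun θ θ' e =>
    injective_corePt (smul_right_injective _ (by norm_num : (2⁻¹ : ℝ) ≠ 0)
      (congrArg (fun y : ↥(handleTube 3 2) => y.1.1) e))
  let e : sphere (0 : EuclideanSpace ℝ (Fin 2)) 1 ≃ₜ
      ↥{y : ↥(handleTube 3 2) | lamSq 2 y.1.1 = (2⁻¹ : ℝ) ^ 2 ∧ muSq 2 y.1.1 = 0} :=
    (hc.isClosedEmbedding hinj).isEmbedding.toHomeomorph.trans (Homeomorph.setCongr range_circPt)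
  have h𝕊 : IsZero (singularHomology R R ↥(sphere (0 : EuclideanSpace ℝ (Fin 2)) 1) (k + 2)) :=
    isZero_singularHomology_sphere_holds R R (n := 1) (by omega) (by omega)
  exact h𝕊.of_iso (singularHomology.mapIso R R e (k + 2)).symm

/-- **The punctured tube `T ∖ S` is a homology circle: `Hₖ₊₂(T ∖ S; R) = 0`** (it retracts onto
`K_{1/2}`). [cite: Kosinski1993, VI §6] [cite: HatcherAT2002, Cor. 2.14] -/
theorem isZero_singularHomology_puncturedTube (k : ℕ) :
    IsZero (singularHomology R R ↥{y : ↥(handleTube 3 2) | lamSq 2 y.1.1 ≠ 1} (k + 2)) := by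
  have hK : {y : ↥(handleTube 3 2) | lamSq 2 y.1.1 = (2⁻¹ : ℝ) ^ 2 ∧ muSq 2 y.1.1 = 0} ⊆
      {y : ↥(handleTube 3 2) | lamSq 2 y.1.1 ≠ 1} := by
    rintro y ⟨hy, -⟩
    show lamSq 2 y.1.1 ≠ 1
    rw [hy]; norm_num
  haveI := isIso_map_subsetInclusion_of_sdr R R
    (isStrongDeformationRetractOf_parallel₄_of_lt (c := 2⁻¹) (by norm_num) (by norm_num)) hK (k + 2)
  exact (isZero_singularHomology_parallelCircle R k).of_iso
    (asIso (singularHomology.map R R (subsetInclusion hK) (k + 2))).symm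

/-! ## §2 Degrees `≥ 3`: no hypothesis on the attaching classes -/

section Three

variable {Y : Type} [TopologicalSpace Y] {ι : Type} {A : Set Y} {B : ι → Set Y}

/-- **Finset induction in degrees `≥ 3`**: with acyclic pieces `Bᵢ` and edges `A ∩ Bᵢ` acyclic
above degree `1`, `Hₖ₊₃(A) → Hₖ₊₃(A ∪ ⋃_{i ∈ s} Bᵢ)` is an isomorphism (the Mayer–Vietoris step
`isIso_map_succ_union` with both neighbours of `Hₖ₊₃` of the edge vanishing).
[cite: HatcherAT2002, §2.2 p. 149] -/
theorem isIso_map_add_three_finset (hA : IsOpen A) (hB : ∀ i, IsOpen (B i))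
    (hdisj : Pairwise fun i j => Disjoint (B i) (B j))
    (hBk : ∀ i k, IsZero (singularHomology R R ↥(B i) (k + 1)))
    (hIk : ∀ i k, IsZero (singularHomology R R ↥(A ∩ B i) (k + 2))) (s : Finset ι) :
    ∀ (P : Set Y) (hP : A ⊆ P), P = A ∪ ⋃ i ∈ s, B i →
      ∀ k, IsIso (singularHomology.map R R (subsetInclusion hP) (k + 3)) := by
  classical
  induction s using Finset.induction_on with
  | empty =>
    intro P hP hPe k
    exact isIso_map_subsetInclusion_of_subset R R hP (by rw [hPe]; simp) _
  | @insert i s his ih =>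
    intro P hP hPe k
    set Q : Set Y := A ∪ ⋃ i ∈ s, B i with hQ
    have hAQ : A ⊆ Q := subset_union_left
    obtain rfl : P = Q ∪ B i := by
      rw [hPe, hQ, Finset.set_biUnion_insert]; ac_rfl
    have hQi : Q ∩ B i = A ∩ B i := by
      rw [hQ, union_inter_distrib_right]
      refine union_eq_left.2 ?_
      rintro a ⟨ha, hai⟩
      obtain ⟨j, hj, haj⟩ := mem_iUnion₂.1 ha
      have hji : j ≠ i := fun e => his (e ▸ hj)
      exact absurd hai (Set.disjoint_left.1 (hdisj hji) haj)
    have hQo : IsOpen Q := hA.union (isOpen_biUnion fun i _ => hB i)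
    haveI : Mono (singularHomology.map R R (subsetInclusion (inter_subset_left :
        Q ∩ B i ⊆ Q)) (k + 2)) :=
      ⟨fun _ _ _ => (isZero_congr_set R hQi _ (hIk i k)).eq_of_tgt _ _⟩
    haveI := isIso_map_succ_union R R hQo (hB i) (k + 2)
      (isZero_congr_set R hQi _ (hIk i (k + 1))) (hBk i (k + 2))
    haveI := ih Q hAQ rfl k
    rw [show singularHomology.map R R (subsetInclusion hP) (k + 3) =
        singularHomology.map R R (subsetInclusion hAQ) (k + 3) ≫
          singularHomology.map R R (subsetInclusion (subset_union_left : Q ⊆ Q ∪ B i)) (k + 3)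
      by rw [← singularHomology.map_comp]; rfl]
    infer_instance

/-- **`Hₖ₊₃(A; R) ≅ Hₖ₊₃(X; R)`** for `X = A ∪ ⋃ᵢ Bᵢ` with acyclic open pieces `Bᵢ` and edges
`A ∩ Bᵢ` acyclic above degree `1` (no hypothesis on `H₁` of the edges).
[cite: HatcherAT2002, §2.2 p. 149] -/
theorem isIso_map_add_three_cover [Finite ι] (hA : IsOpen A) (hB : ∀ i, IsOpen (B i))
    (hdisj : Pairwise fun i j => Disjoint (B i) (B j)) (hcov : A ∪ ⋃ i, B i = univ)
    (hBk : ∀ i k, IsZero (singularHomology R R ↥(B i) (k + 1)))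
    (hIk : ∀ i k, IsZero (singularHomology R R ↥(A ∩ B i) (k + 2))) (k : ℕ) :
    IsIso (singularHomology.map R R (subsetIncl A) (k + 3)) := by
  classical
  haveI := Fintype.ofFinite ι
  have hcov' : (univ : Set Y) = A ∪ ⋃ i ∈ (Finset.univ : Finset ι), B i := by
    rw [← hcov]; congr 1; ext x; simp
  haveI := isIso_map_add_three_finset R hA hB hdisj hBk hIk Finset.univ univ (subset_univ A) hcov' k
  haveI := isIso_map_subsetIncl_univ R R (X := Y) (k + 3)
  rw [show singularHomology.map R R (subsetIncl A) (k + 3) =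
      singularHomology.map R R (subsetInclusion (subset_univ A)) (k + 3) ≫
        singularHomology.map R R (subsetIncl (univ : Set Y)) (k + 3)
    by rw [← singularHomology.map_comp]; rfl]
  infer_instance

end Three

/-! ## §3 E2: `Hₖ₊₂(X; R) ≅ Hₖ₊₂(V; R)` for independent attaching classes; `Hₖ₊₃` always -/

section Engine

variable {V : Type} [TopologicalSpace V] [T2Space V] [ChartedSpace (EuclideanHalfSpace (3 + 1)) V]
  {ι : Type} [Finite ι] {h : ι → HandleAttachingMap 3 2 V}
  {X : Type} [TopologicalSpace X]
  {jA : ↥(HandleAttachingMap.coresComplement h) → X} {jB : ι → ↥(beltPiece 3 2) → X}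

omit [Finite ι] in
/-- For a linearly independent family, `r • v i = 0` forces `r = 0`. [folklore] -/
theorem smul_eq_zero_of_linearIndependent {M : Type*} [AddCommGroup M] [Module R M] {v : ι → M}
    (hv : LinearIndependent R v) (i : ι) {r : R} (hr : r • v i = 0) : r = 0 := by
  classical
  have h := (linearIndependent_iff'.1 hv) {i} (fun _ => r) (by simpa using hr) i
    (Finset.mem_singleton_self i)
  exact h

/-- **E2 with the multi-attachment data explicit**: `Hₖ₊₂(A) → Hₖ₊₂(X)` is an isomorphism when
the attaching classes are linearly independent in `H₁(V; R)`. [cite: GompfStipsicz1999, §4.4] -/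
theorem isIso_map_add_two_of_data {EP HP : Type*} [NormedAddCommGroup EP]
    [NormedSpace ℝ EP] [TopologicalSpace HP] {IP : ModelWithCorners ℝ EP HP} [ChartedSpace HP X]
    (hdisj : Pairwise fun i j => Disjoint (range (h i).toFun) (range (h j).toFun))
    (hjA : Manifold.IsSmoothEmbedding (𝓡∂ (3 + 1)) IP ∞ jA) (hjAo : IsOpen (range jA))
    (hjB : ∀ i, Manifold.IsSmoothEmbedding (𝓡∂ (3 + 1)) IP ∞ (jB i) ∧ IsOpen (range (jB i)))
    (hcov : range jA ∪ (⋃ i, range (jB i)) = univ)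
    (hglue : ∀ i a b, jA a = jB i b ↔
      (h i).glueRel (a : V) (b : closedBall (0 : EuclideanSpace ℝ (Fin 4)) 1))
    (hdisjB : Pairwise fun i j => Disjoint (range (jB i)) (range (jB j)))
    (hli : LinearIndependent R fun i => loopClass R R (1 : R)
      (loopPath (h i).attachingCircle (h i).continuous_attachingCircle)) (k : ℕ) :
    IsIso (singularHomology.map R R (subsetIncl (range jA)) (k + 2)) := by
  obtain ⟨y₀, L, hL, hLclass⟩ := stub_multiAttachment_tubeModel
  haveI hTS : PathConnectedSpace ↥{y : ↥(handleTube 3 2) | lamSq 2 y.1.1 ≠ 1} :=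
    isPathConnected_iff_pathConnectedSpace.1 isPathConnected_handleTube₄_lamSq_ne_one
  have hpcB : ∀ i, ContractibleSpace ↥(range (jB i)) := fun i =>
    (hjB i).1.isEmbedding.toHomeomorph.contractibleSpace_iff.1 contractibleSpace_beltPiece₄
  -- the edge homeomorphisms and classes
  let e : ∀ i, ↥{y : ↥(handleTube 3 2) | lamSq 2 y.1.1 ≠ 1} ≃ₜ ↥(range jA ∩ range (jB i)) :=
    fun i => (isEmbedding_tubePiece hjA.isEmbedding hdisj i).toHomeomorph.trans
      (Homeomorph.setCongr (range_tubePiece_eq hdisj hglue i))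
  let c : ι → singularHomology R R ↥(range jA) 1 := fun i => loopClass R R (1 : R) (L.map
    ((continuous_inclusion (inter_subset_left : range jA ∩ range (jB i) ⊆ range jA)).comp
      (e i).continuous))
  have hc := range_edge_eq_span R hjA.isEmbedding hdisj hglue L hL
  -- independence of the `cᵢ` in `H₁(A)`, read in `H₁(V)`
  let T : singularHomology R R ↥(range jA) 1 →ₗ[R] singularHomology R R V 1 :=
    (singularHomology.map R R (subsetIncl
        ((HandleAttachingMap.coresComplement h : TopologicalSpace.Opens V) : Set V)) 1).hom ∘ₗ
      (singularHomology.map R R (hjA.isEmbedding.toHomeomorph.symm :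
          C(↥(range jA), ↥(HandleAttachingMap.coresComplement h))) 1).hom
  have hTc : (T ∘ c) = fun i => loopClass R R (1 : R)
      (loopPath (h i).attachingCircle (h i).continuous_attachingCircle) :=
    funext fun i => map_edgeClass_eq R hdisj hjA hglue L (fun h' => hLclass R V h') i
  have hli' : LinearIndependent R c := LinearIndependent.of_comp T (by rw [hTc]; exact hli)
  refine isIso_map_add_two_cover R hjAo (fun i => (hjB i).2) hdisjB hcov
    (fun i k => isZero_singularHomology_of_contractibleSpace R R (Nat.succ_ne_zero k))
    (fun i k => (isZero_singularHomology_puncturedTube R k).of_iso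
      (singularHomology.mapIso R R (e i) (k + 2)).symm) hc (fun i => ?_) hli' k
  -- injectivity of the edge `H₁(A ∩ Bᵢ) → H₁(A)`: `H₁(T ∖ S) = R ∙ [L]` and `r • cᵢ = 0 ⇒ r = 0`
  have hspan := span_loopClass_eq_top_of_zpow R L hL
  rw [injective_iff_map_eq_zero]
  intro x hx
  obtain ⟨x', rfl⟩ : ∃ x', (singularHomology.mapIso R R (e i) 1).hom x' = x :=
    ((ConcreteCategory.isIso_iff_bijective (singularHomology.mapIso R R (e i) 1).hom).1
      inferInstance).2 x
  have hx' : x' ∈ Submodule.span R {loopClass R R (1 : R) L} := by rw [hspan]; trivial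
  obtain ⟨r, rfl⟩ := Submodule.mem_span_singleton.1 hx'
  have hr : r • c i = 0 := by
    have e₁ : singularHomology.map R R (subsetInclusion (inter_subset_left :
        range jA ∩ range (jB i) ⊆ range jA)) 1 ((singularHomology.mapIso R R (e i) 1).hom
          (r • loopClass R R (1 : R) L)) = r • c i := by
      rw [map_smul, map_smul, singularHomology.mapIso_hom, ← ModuleCat.comp_apply,
        ← singularHomology.map_comp, map_loopClass]
      rfl
    rw [← e₁]; exact hx
  rw [smul_eq_zero_of_linearIndependent R hli' i hr, zero_smul, map_zero]

/-- **E2: `Hₖ₊₂(X; R) ≅ Hₖ₊₂(V; R)` for a Kosinski multi-attachment of 4-dimensional 2-handles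
whose attaching classes are linearly independent in `H₁(V; R)`** (always true in degrees `≥ 3`
on paper; the independence is what the degree-2 step needs). [cite: GompfStipsicz1999, §4.4] -/
theorem IsMultiAttachment.nonempty_iso_of_linearIndependent {EP HP : Type*} [NormedAddCommGroup EP]
    [NormedSpace ℝ EP] [TopologicalSpace HP] {IP : ModelWithCorners ℝ EP HP} [ChartedSpace HP X]
    (hX : HandleAttachingMap.IsMultiAttachment h IP X)
    (hli : LinearIndependent R fun i => loopClass R R (1 : R)
      (loopPath (h i).attachingCircle (h i).continuous_attachingCircle)) (k : ℕ) :
    Nonempty (singularHomology R R X (k + 2) ≅ singularHomology R R V (k + 2)) := by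
  obtain ⟨hdisj, jA, jB, hjA, hjAo, hjB, hcov, hglue, hdisjB⟩ := hX
  haveI := isIso_map_add_two_of_data R hdisj hjA hjAo hjB hcov hglue hdisjB hli k
  haveI : IsIso (singularHomology.map R R (subsetIncl
      ((HandleAttachingMap.coresComplement h : TopologicalSpace.Opens V) : Set V)) (k + 2)) :=
    isIso_map_coresComplement_succ R R hdisj (k + 1)
  exact ⟨(asIso (singularHomology.map R R (subsetIncl (range jA)) (k + 2))).symm ≪≫
    (singularHomology.mapIso R R hjA.isEmbedding.toHomeomorph (k + 2)).symm ≪≫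
    asIso (singularHomology.map R R (subsetIncl
      ((HandleAttachingMap.coresComplement h : TopologicalSpace.Opens V) : Set V)) (k + 2))⟩

/-- **E2 in degrees `≥ 3`, unconditionally: `Hₖ₊₃(X; R) ≅ Hₖ₊₃(V; R)`** for every Kosinski
multi-attachment of 4-dimensional 2-handles (the edges `T ∖ S ≃ S¹` have no homology above
degree `1`). [cite: GompfStipsicz1999, §4.4] -/
theorem IsMultiAttachment.nonempty_iso_add_three {EP HP : Type*} [NormedAddCommGroup EP]
    [NormedSpace ℝ EP] [TopologicalSpace HP] {IP : ModelWithCorners ℝ EP HP} [ChartedSpace HP X]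
    (hX : HandleAttachingMap.IsMultiAttachment h IP X) (k : ℕ) :
    Nonempty (singularHomology R R X (k + 3) ≅ singularHomology R R V (k + 3)) := by
  obtain ⟨hdisj, jA, jB, hjA, hjAo, hjB, hcov, hglue, hdisjB⟩ := hX
  have hpcB : ∀ i, ContractibleSpace ↥(range (jB i)) := fun i =>
    (hjB i).1.isEmbedding.toHomeomorph.contractibleSpace_iff.1 contractibleSpace_beltPiece₄
  let e : ∀ i, ↥{y : ↥(handleTube 3 2) | lamSq 2 y.1.1 ≠ 1} ≃ₜ ↥(range jA ∩ range (jB i)) :=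
    fun i => (isEmbedding_tubePiece hjA.isEmbedding hdisj i).toHomeomorph.trans
      (Homeomorph.setCongr (range_tubePiece_eq hdisj hglue i))
  haveI := isIso_map_add_three_cover R hjAo (fun i => (hjB i).2) hdisjB hcov
    (fun i k => isZero_singularHomology_of_contractibleSpace R R (Nat.succ_ne_zero k))
    (fun i k => (isZero_singularHomology_puncturedTube R k).of_iso
      (singularHomology.mapIso R R (e i) (k + 2)).symm) k
  haveI : IsIso (singularHomology.map R R (subsetIncl
      ((HandleAttachingMap.coresComplement h : TopologicalSpace.Opens V) : Set V)) (k + 3)) :=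
    isIso_map_coresComplement_succ R R hdisj (k + 2)
  exact ⟨(asIso (singularHomology.map R R (subsetIncl (range jA)) (k + 3))).symm ≪≫
    (singularHomology.mapIso R R hjA.isEmbedding.toHomeomorph (k + 3)).symm ≪≫
    asIso (singularHomology.map R R (subsetIncl
      ((HandleAttachingMap.coresComplement h : TopologicalSpace.Opens V) : Set V)) (k + 3))⟩

/-! ## §4 Acyclicity -/

/-- **Acyclicity of a multi-attachment whose attaching classes form a basis of `H₁(V; R)` over
an `R`-acyclic `V`**: if the attaching classes are linearly independent and span `H₁(V; R)`, and
`Hₖ(V; R) = 0` for `k ≥ 2`, then `Hₖ(X; R) = 0` for every `k ≥ 1` (E1 in degree `1`, E2 above).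
[cite: GompfStipsicz1999, §4.4] -/
theorem IsMultiAttachment.isZero_of_span_eq_top {EP HP : Type*} [NormedAddCommGroup EP]
    [NormedSpace ℝ EP] [TopologicalSpace HP] {IP : ModelWithCorners ℝ EP HP} [ChartedSpace HP X]
    (hX : HandleAttachingMap.IsMultiAttachment h IP X)
    (hli : LinearIndependent R fun i => loopClass R R (1 : R)
      (loopPath (h i).attachingCircle (h i).continuous_attachingCircle))
    (hsp : Submodule.span R (range fun i => loopClass R R (1 : R)
      (loopPath (h i).attachingCircle (h i).continuous_attachingCircle)) = ⊤)
    (hV : ∀ k, IsZero (singularHomology R R V (k + 2))) :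
    ∀ k, IsZero (singularHomology R R X (k + 1))
  | 0 => by
    obtain ⟨e⟩ := IsMultiAttachment.nonempty_equiv_quot_span R hX
    rw [hsp] at e
    haveI : Subsingleton (singularHomology R R X 1) := e.toEquiv.subsingleton
    exact ModuleCat.isZero_of_subsingleton _
  | k + 1 => by
    obtain ⟨e⟩ := IsMultiAttachment.nonempty_iso_of_linearIndependent R hX hli k
    exact (hV k).of_iso e

/-- **E2 = registered sub-goal stub `stub_multiAttachment_Hk`** of
`stub_isLefschetzHandlebody_homology`: `Hₖ₊₂(X; R) ≅ Hₖ₊₂(V; R)` for a Kosinski multi-attachment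
`X` of 4-dimensional 2-handles to `V` with linearly independent attaching classes
(Gompf–Stipsicz 1999, §4.4). [cite: GompfStipsicz1999, §4.4] -/
theorem stub_multiAttachment_Hk : ∀ (R : Type) [CommRing R] (V : Type) [TopologicalSpace V]
    [T2Space V] [ChartedSpace (EuclideanHalfSpace (3 + 1)) V] (ι : Type) [Finite ι]
    (h : ι → Literature.Topology.FourManifolds.HandleAttachingMap 3 2 V) (X : Type)
    [TopologicalSpace X] [ChartedSpace (EuclideanHalfSpace 4) X],
    Literature.Topology.FourManifolds.HandleAttachingMap.IsMultiAttachment h (𝓡∂ 4) X →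
    LinearIndependent R (fun i =>
      Literature.AlgebraicTopology.SingularHomology.loopClass R R (1 : R)
        (Literature.Topology.FourManifolds.LefschetzBase.loopPath (h i).attachingCircle
          (h i).continuous_attachingCircle)) →
    ∀ k : ℕ, Nonempty (Literature.AlgebraicTopology.SingularHomology.singularHomology R R X (k + 2) ≅
      Literature.AlgebraicTopology.SingularHomology.singularHomology R R V (k + 2)) :=
  fun R _ _ _ _ _ _ _ _ _ _ _ hX hli k => IsMultiAttachment.nonempty_iso_of_linearIndependent R hX hli k

end Engine

end Summit.SmoothPoincare4.SmoothPoincare4.Theorems.AcyclicBisectionExists.ModpBraidOrbits
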